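import Mathlib
import Summits.KontsevichZagierPeriods.KontsevichZagierPeriods.Theorems.SoloInformedHTSetting
import Summits.KontsevichZagierPeriods.KontsevichZagierPeriods.Theorems.SoloInformedGridKappa
import Summits.KontsevichZagierPeriods.KontsevichZagierPeriods.Theorems.SoloInformedKappaPathCongr
import HarnessLib

/-!
# SoloInformed — the Stokes grid of a homotopy, II: edges

File I4e of the (HT) step (`SoloInformedNashHT`) of the solo-informed programme.  With the scales,
grid points, vertices and charts of `SoloInformedHTSetting.lean`:

* horizontal edges `hor i j` (from `vert i j` to `vert (i+1) j`): constant on the bottom and top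
  rows (where the homotopy is constant), chords of the edge charts otherwise;
* vertical edges `ver i j` (from `vert i j` to `vert i (j+1)`): the pieces of `a` and `b` in
  column `0`, the pieces of `d` in column `N`, chords of the edge charts otherwise;
and the verification that every edge is a Nash map with the right end points, that the four edges
of cell `(i, j)` run in the core of the cell chart, and that `κOpt` vanishes on the bottom and top
rows — i.e. all hypotheses of `soloInformed_grid_hcell` / `soloInformed_HT_of_grid`
(`SoloInformedRungTwoFinal.lean`).

References: Huber–Wüstholz, *Transcendence and linear relations of 1-periods* (2022), §7.2;
Bochnak–Coste–Roy, *Real algebraic geometry* (1998), Prop. 8.1.8.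
-/

noncomputable section

open scoped Topology unitInterval
open Set Metric MvPolynomial
open Literature.NumberTheory.Transcendental Literature.NumberTheory.Transcendental.KZ
open Literature.NumberTheory.Transcendental.CurvePeriods
open Literature.ModelTheory.ExponentialFields

open Literature.AlgebraicTopology.Homotopy (clampI clampI_zero clampI_one coe_clampI_of_mem)

namespace Summit.KontsevichZagierPeriods.KontsevichZagierPeriods.Theorems

/-! ## 0. `κOpt` of constants -/

/-- `κOpt` of a constant map with algebraic coordinates vanishes. -/
theorem soloInformedKappaOpt_const {n : ℕ} (ω : Fin n → MvPolynomial (Fin n) ℂ)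
    (hω : ∀ i, HasAlgCoeffs (ω i)) (p : Fin n → ℂ) (hp : ∀ i, IsAlgebraic ℚ (p i)) :
    soloInformedKappaOpt ω hω (fun _ : ℝ => p) = 0 := by
  rw [soloInformedKappaOpt_eq ω hω (soloInformed_isNashPath_constFun p hp)]
  exact soloInformed_kappaPath_const ω hω p _

variable {Z : CurveData}

namespace SoloInformedHTScale

variable {S : SoloInformedHTSetting Z} (P : SoloInformedHTScale S)

/-! ## 1. The edges -/

/-- **Horizontal edges.** -/
def hor (i j : ℕ) : ℝ → Fin Z.n → ℂ :=
  if j = 0 ∨ j = P.M then fun _ => P.gpt i j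
  else soloInformedChord (P.edgeChart i j) (P.vert i j) (P.vert (i + 1) j)

/-- **Vertical edges.** -/
def ver (i j : ℕ) : ℝ → Fin Z.n → ℂ :=
  if i = 0 then
    (if j < P.M₀ then soloInformedPiecePath S.a P.M₀ j else soloInformedPiecePath S.b P.M₀ (j - P.M₀))
  else if i = P.N then soloInformedPiecePath S.d P.M j
  else soloInformedChord (P.edgeChart i j) (P.vert i j) (P.vert i (j + 1))

/-- On the bottom and top rows the horizontal edges are constant. -/
theorem hor_of_bdry {i j : ℕ} (h : j = 0 ∨ j = P.M) : P.hor i j = fun _ => P.gpt i j := by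
  rw [hor, if_pos h]

/-- Off the bottom and top rows the horizontal edges are chords of the edge charts. -/
theorem hor_of_not_bdry {i j : ℕ} (h : ¬(j = 0 ∨ j = P.M)) :
    P.hor i j = soloInformedChord (P.edgeChart i j) (P.vert i j) (P.vert (i + 1) j) := by
  rw [hor, if_neg h]

/-- In the middle columns the vertical edges are chords of the edge charts. -/
theorem ver_mid {i j : ℕ} (h0 : i ≠ 0) (hN : i ≠ P.N) :
    P.ver i j = soloInformedChord (P.edgeChart i j) (P.vert i j) (P.vert i (j + 1)) := by
  rw [ver, if_neg h0, if_neg hN]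

/-- The lower half of column `0` consists of the `M₀` pieces of `a`. -/
theorem verA {j : ℕ} (hj : j < P.M₀) : P.ver 0 j = soloInformedPiecePath S.a P.M₀ j := by
  rw [ver, if_pos rfl, if_pos hj]

/-- The upper half of column `0` consists of the `M₀` pieces of `b`. -/
theorem verB (j : ℕ) : P.ver 0 (P.M₀ + j) = soloInformedPiecePath S.b P.M₀ j := by
  rw [ver, if_pos rfl, if_neg (by omega), Nat.add_sub_cancel_left]

/-- Column `N` consists of the `M` pieces of `d`. -/
theorem verD (j : ℕ) : P.ver P.N j = soloInformedPiecePath S.d P.M j := by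
  rw [ver, if_neg P.N_pos.ne', if_pos rfl]

/-! ## 2. Values of the column edges -/

/-- The parameter `(j + u) / M` of a column piece lies in `[0, 1]`. -/
theorem col_param_mem {j : ℕ} (hj : j < P.M) {u : ℝ} (hu : u ∈ Icc (0 : ℝ) 1) :
    ((j : ℝ) + u) / P.M ∈ Icc (0 : ℝ) 1 := by
  have hM : (0 : ℝ) < P.M := by exact_mod_cast P.M_spec.2
  have hj' : (j : ℝ) + 1 ≤ P.M := by exact_mod_cast Nat.succ_le_of_lt hj
  exact ⟨by have := hu.1; positivity, (div_le_one hM).2 (by linarith [hu.2])⟩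

/-- Column `0` follows `a · b`. -/
theorem ver_col_zero_apply {j : ℕ} (hj : j < P.M) {u : ℝ} (hu : u ∈ Icc (0 : ℝ) 1) :
    P.ver 0 j u = S.G (0, clampI (((j : ℝ) + u) / P.M)) := by
  have hM : (0 : ℝ) < P.M₀ := by exact_mod_cast P.M₀_pos
  rw [S.G_zero_left, coe_clampI_of_mem (P.col_param_mem hj hu), ver, if_pos rfl]
  split_ifs with h
  · have hj' : (j : ℝ) + 1 ≤ P.M₀ := by exact_mod_cast Nat.succ_le_of_lt h
    rw [S.cat_of_le (by rw [P.cast_M, div_le_iff₀ (by positivity)]; linarith [hu.2]),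
      soloInformedPiecePath, show 2 * (((j : ℝ) + u) / P.M) = ((j : ℝ) + u) / P.M₀ by
        rw [P.cast_M]; field_simp; ring]
  · have hj' : (P.M₀ : ℝ) ≤ j := by exact_mod_cast not_lt.1 h
    rw [S.cat_of_ge (by rw [P.cast_M, le_div_iff₀ (by positivity)]; linarith [hu.1]),
      soloInformedPiecePath, Nat.cast_sub (not_lt.1 h),
      show 2 * (((j : ℝ) + u) / P.M) - 1 = ((j : ℝ) - P.M₀ + u) / P.M₀ by
        rw [P.cast_M]; field_simp; ring]

/-- Column `N` follows `d`. -/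
theorem ver_col_N_apply {j : ℕ} (hj : j < P.M) {u : ℝ} (hu : u ∈ Icc (0 : ℝ) 1) :
    P.ver P.N j u = S.G (1, clampI (((j : ℝ) + u) / P.M)) := by
  rw [S.G_right, coe_clampI_of_mem (P.col_param_mem hj hu), P.verD]
  rfl

/-! ## 3. End points -/

/-- A horizontal edge starts at the vertex `(i, j)`. -/
theorem hor_zero (i j : ℕ) : P.hor i j 0 = P.vert i j := by
  by_cases h : j = 0 ∨ j = P.M
  · rw [P.hor_of_bdry h, P.vert_of_bdry (Or.inr (Or.inr h))]
  · rw [P.hor_of_not_bdry h]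
    exact soloInformed_chord_zero _ (P.vert_mem_core_edge i j) _

/-- A horizontal edge ends at the vertex `(i + 1, j)`. -/
theorem hor_one (i j : ℕ) : P.hor i j 1 = P.vert (i + 1) j := by
  by_cases h : j = 0 ∨ j = P.M
  · rw [P.hor_of_bdry h, P.vert_of_bdry (Or.inr (Or.inr h))]
    rcases h with rfl | rfl
    · simp only [P.gpt_row_zero]
    · simp only [P.gpt_row_M]
  · rw [P.hor_of_not_bdry h]
    exact soloInformed_chord_one _ _ (P.vert_succ_fst_mem_core_edge i j)

/-- A vertical edge starts at the vertex `(i, j)`. -/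
theorem ver_zero {i j : ℕ} (hi : i ≤ P.N) (hj : j < P.M) : P.ver i j 0 = P.vert i j := by
  by_cases h0 : i = 0
  · subst h0
    rw [P.ver_col_zero_apply hj ⟨le_rfl, zero_le_one⟩, add_zero, P.vert_of_bdry (Or.inl rfl),
      P.gpt_col_zero]
  by_cases hN : i = P.N
  · subst hN
    rw [P.ver_col_N_apply hj ⟨le_rfl, zero_le_one⟩, add_zero,
      P.vert_of_bdry (Or.inr (Or.inl rfl)), P.gpt_col_N]
  · rw [P.ver_mid h0 hN]
    exact soloInformed_chord_zero _ (P.vert_mem_core_edge i j) _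

/-- A vertical edge ends at the vertex `(i, j + 1)`. -/
theorem ver_one {i j : ℕ} (hi : i ≤ P.N) (hj : j < P.M) : P.ver i j 1 = P.vert i (j + 1) := by
  by_cases h0 : i = 0
  · subst h0
    rw [P.ver_col_zero_apply hj ⟨zero_le_one, le_rfl⟩, P.vert_of_bdry (Or.inl rfl),
      P.gpt_col_zero, Nat.cast_succ]
  by_cases hN : i = P.N
  · subst hN
    rw [P.ver_col_N_apply hj ⟨zero_le_one, le_rfl⟩, P.vert_of_bdry (Or.inr (Or.inl rfl)),
      P.gpt_col_N, Nat.cast_succ]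
  · rw [P.ver_mid h0 hN]
    exact soloInformed_chord_one _ _ (P.vert_succ_snd_mem_core_edge i j)

/-! ## 4. Nash -/

/-- Horizontal edges are Nash maps (constants with algebraic coordinates, or chords between algebraic core points). -/
theorem hor_nash (hZ : Z.IsSmoothAffineCurve) {i j : ℕ} (hi : i < P.N) (hj : j ≤ P.M) :
    SoloInformedIsNashPath (P.hor i j) := by
  by_cases h : j = 0 ∨ j = P.M
  · rw [P.hor_of_bdry h]
    exact soloInformed_isNashPath_constFun _ (P.gpt_alg_bdry hi.le hj (Or.inr (Or.inr h)))
  · rw [P.hor_of_not_bdry h]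
    exact soloInformed_isNashPath_chord _ hZ (P.vert_mem_core_edge i j)
      (P.vert_succ_fst_mem_core_edge i j) (P.vert_alg hZ hi.le hj) (P.vert_alg hZ hi hj)

/-- Vertical edges are Nash maps (pieces of the Nash paths `a, b, d`, or chords). -/
theorem ver_nash (hZ : Z.IsSmoothAffineCurve) {i j : ℕ} (hi : i ≤ P.N) (hj : j < P.M) :
    SoloInformedIsNashPath (P.ver i j) := by
  by_cases h0 : i = 0
  · subst h0
    by_cases h : j < P.M₀
    · rw [P.verA h]
      exact soloInformed_isNashPath_piece S.ha h
    · obtain ⟨k, rfl⟩ := Nat.exists_eq_add_of_le (not_lt.1 h)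
      rw [P.verB k]
      exact soloInformed_isNashPath_piece S.hb (by change P.M₀ + k < P.M₀ + P.M₀ at hj; omega)
  by_cases hN : i = P.N
  · subst hN
    rw [P.verD]
    exact soloInformed_isNashPath_piece S.hd hj
  · rw [P.ver_mid h0 hN]
    exact soloInformed_isNashPath_chord _ hZ (P.vert_mem_core_edge i j)
      (P.vert_succ_snd_mem_core_edge i j) (P.vert_alg hZ hi hj.le) (P.vert_alg hZ hi hj)

/-! ## 5. Edges run near their grid points -/

/-- A horizontal edge runs through curve points within `ρ / 4` of its grid point. -/
theorem hor_near (i j : ℕ) (u : ℝ) :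
    P.hor i j u ∈ Z.points ∧ dist (P.hor i j u) (P.gpt i j) < P.ρ / 4 := by
  by_cases h : j = 0 ∨ j = P.M
  · rw [P.hor_of_bdry h, dist_self]
    exact ⟨P.gpt_mem i j, by linarith [P.ρ_pos]⟩
  · rw [P.hor_of_not_bdry h]
    have hc := soloInformed_chord_mem_core _ (P.vert_mem_core_edge i j)
      (P.vert_succ_fst_mem_core_edge i j) u
    exact ⟨hc.1, P.dist_lt_of_mem_core_edge hc⟩

/-- On `[0, 1]` a vertical edge runs through curve points within `ρ / 4` of its grid point. -/
theorem ver_near {i j : ℕ} (hi : i ≤ P.N) (hj : j < P.M) {u : ℝ} (hu : u ∈ Icc (0 : ℝ) 1) :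
    P.ver i j u ∈ Z.points ∧ dist (P.ver i j u) (P.gpt i j) < P.ρ / 4 := by
  have hM : (0 : ℝ) < P.M := by exact_mod_cast P.M_spec.2
  have hpar : |((j : ℝ) + u) / P.M - (j : ℝ) / P.M| ≤ 1 / (P.M : ℝ) := by
    rw [show ((j : ℝ) + u) / P.M - (j : ℝ) / P.M = u / P.M by ring, abs_of_nonneg (by
      have := hu.1; positivity)]
    exact div_le_div_of_nonneg_right hu.2 hM.le
  by_cases h0 : i = 0
  · subst h0
    rw [P.ver_col_zero_apply hj hu, P.gpt_col_zero]
    exact ⟨S.G_mem _, by linarith [P.dist_G_snd_lt 0 hpar, P.δ_le]⟩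
  by_cases hN : i = P.N
  · subst hN
    rw [P.ver_col_N_apply hj hu, P.gpt_col_N]
    exact ⟨S.G_mem _, by linarith [P.dist_G_snd_lt 1 hpar, P.δ_le]⟩
  · rw [P.ver_mid h0 hN]
    have hc := soloInformed_chord_mem_core _ (P.vert_mem_core_edge i j)
      (P.vert_succ_snd_mem_core_edge i j) u
    exact ⟨hc.1, P.dist_lt_of_mem_core_edge hc⟩

/-! ## 6. The four edges of a cell run in the core of the cell chart -/

/-- The bottom edge of cell `(i, j)` runs in the core of the cell chart. -/
theorem hor_mem_core_cell (i j : ℕ) (u : ℝ) :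
    P.hor i j u ∈ soloInformedCore (P.cellChart i j) := by
  obtain ⟨hz, hd⟩ := P.hor_near i j u
  exact P.mem_core_cell hz (by linarith [P.ρ_pos])

/-- The top edge of cell `(i, j)` runs in the core of the cell chart. -/
theorem hor_succ_mem_core_cell (i j : ℕ) (u : ℝ) :
    P.hor i (j + 1) u ∈ soloInformedCore (P.cellChart i j) := by
  obtain ⟨hz, hd⟩ := P.hor_near i (j + 1) u
  refine P.mem_core_cell hz ?_
  calc dist (P.hor i (j + 1) u) (P.gpt i j)
      ≤ dist (P.hor i (j + 1) u) (P.gpt i (j + 1)) + dist (P.gpt i (j + 1)) (P.gpt i j) :=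
        dist_triangle _ _ _
    _ < P.ρ / 4 + P.δ / 4 := add_lt_add hd (P.dist_gpt_succ_snd i j)
    _ ≤ P.ρ := by linarith [P.δ_le, P.ρ_pos]

/-- On `[0, 1]` the left edge of cell `(i, j)` runs in the core of the cell chart. -/
theorem ver_mem_core_cell {i j : ℕ} (hi : i < P.N) (hj : j < P.M) {u : ℝ}
    (hu : u ∈ Icc (0 : ℝ) 1) : P.ver i j u ∈ soloInformedCore (P.cellChart i j) := by
  obtain ⟨hz, hd⟩ := P.ver_near hi.le hj hu
  exact P.mem_core_cell hz (by linarith [P.ρ_pos])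

/-- On `[0, 1]` the right edge of cell `(i, j)` runs in the core of the cell chart. -/
theorem ver_succ_mem_core_cell {i j : ℕ} (hi : i < P.N) (hj : j < P.M) {u : ℝ}
    (hu : u ∈ Icc (0 : ℝ) 1) : P.ver (i + 1) j u ∈ soloInformedCore (P.cellChart i j) := by
  obtain ⟨hz, hd⟩ := P.ver_near (Nat.succ_le_of_lt hi) hj hu
  refine P.mem_core_cell hz ?_
  calc dist (P.ver (i + 1) j u) (P.gpt i j)
      ≤ dist (P.ver (i + 1) j u) (P.gpt (i + 1) j) + dist (P.gpt (i + 1) j) (P.gpt i j) :=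
        dist_triangle _ _ _
    _ < P.ρ / 4 + P.δ / 4 := add_lt_add hd (P.dist_gpt_succ_fst i j)
    _ ≤ P.ρ := by linarith [P.δ_le, P.ρ_pos]

/-! ## 7. The bottom and top rows carry `κOpt = 0` -/

/-- `κOpt` vanishes on the bottom row (constant edges with algebraic coordinates). -/
theorem kappaOpt_hor_bot (ω : Fin Z.n → MvPolynomial (Fin Z.n) ℂ) (hω : ∀ i, HasAlgCoeffs (ω i))
    {i : ℕ} (hi : i < P.N) : soloInformedKappaOpt ω hω (P.hor i 0) = 0 := by
  rw [P.hor_of_bdry (Or.inl rfl)]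
  exact soloInformedKappaOpt_const ω hω _ (P.gpt_alg_bdry hi.le (Nat.zero_le _)
    (Or.inr (Or.inr (Or.inl rfl))))

/-- `κOpt` vanishes on the top row. -/
theorem kappaOpt_hor_top (ω : Fin Z.n → MvPolynomial (Fin Z.n) ℂ) (hω : ∀ i, HasAlgCoeffs (ω i))
    {i : ℕ} (hi : i < P.N) : soloInformedKappaOpt ω hω (P.hor i P.M) = 0 := by
  rw [P.hor_of_bdry (Or.inr rfl)]
  exact soloInformedKappaOpt_const ω hω _ (P.gpt_alg_bdry hi.le le_rfl
    (Or.inr (Or.inr (Or.inr rfl))))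

end SoloInformedHTScale

end Summit.KontsevichZagierPeriods.KontsevichZagierPeriods.Theorems
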